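import Summits.Ventures.YMGap.Thresholds.OneLinkRemainderPrime
import Summits.Ventures.YMGap.Thresholds.OneLinkRemainderGradientL2Q
import HarnessLib

/-!
# Venture YMGap — the one-link modulus beyond first order, part 44: the `L²(ν_B)` gradient norm of the NON-LINEAR part `c₃'` of
# the cubic remainder (quadratic words in `L²`) and the bookkeeping of the linear-bootstrap assembly

HONEST FRAMING: venture file of the cell `pub-ymgap` (QuantumFields programme), strong-coupling LATTICE bookkeeping for `SU(N)`
lattice Yang–Mills; nothing about the continuum or the mass gap in the Clay sense.  No number of record (cell note
`HOME/p2/ONE-LINK-HIERARCHY.md` §15 (1)).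

WHAT.  As `OneLinkRemainderGradientL2Q.sqrt_integral_Gam_c3_le_quad`, for the five-term non-linear part `c₃'`
(`OneLinkRemainderPrime`): the pointwise majorant `P'` loses the constants of the three linear terms, so
* `sqrt_integral_Gam_c3prime_le_quad`: `√∫Γ(c₃',c₃') dν_B ≤ 3κ_w r²‖Δ‖_F + b₁Z₁ + b₂Z₂ + b₃W_{ΔB} + b₄W_{BB}`;
(the real-arithmetic bookkeeping of the bootstrap assembly is `OneLinkLevelTwoBootAlgebra`).

References: cell note `HOME/p2/ONE-LINK-HIERARCHY.md` §4 (4.6), §15 (1).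
-/

noncomputable section

open scoped Matrix ComplexConjugate BigOperators ContDiff Matrix.Norms.Frobenius
open Matrix Complex Finset MeasureTheory ProbabilityTheory
open Literature.MathematicalPhysics.QuantumFieldTheory
open Literature.MathematicalPhysics.QuantumFieldTheory.SUNBakryEmery

namespace Summit.Ventures.YMGap.OneLinkEigen

variable {N : ℕ}

/-- The five-term polynomial `c₃'` is smooth. [folklore] -/
theorem contDiff_c3prime (N : ℕ) (B Δ : Matrix (Fin N) (Fin N) ℂ) :
    ContDiff ℝ ∞ (fun Q : Matrix (Fin N) (Fin N) ℂ =>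
      ((N : ℝ) ^ 2 / (4 * ((N : ℝ) ^ 2 - 4))) / 2 *
          ((Q * B * Q * Δ * Q * B).trace.re + (Q * B * Q * B * Q * Δ).trace.re)
        + 2 * ((N : ℝ) ^ 2 / (4 * ((N : ℝ) ^ 2 - 4))) / N * (Q * B).trace.im * (Q * Δ * Q * B).trace.im
        - 1 / 2 * ((Q * B * Q * B).trace *
            ((((N : ℝ) / (2 * ((N : ℝ) ^ 2 - 4)) : ℝ) : ℂ) * (Q * Δ).trace
              - ((1 / (4 * (N : ℝ)) : ℝ) : ℂ) * (starRingEnd ℂ) (Q * Δ).trace)).re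
        - 1 / 2 * ((Q * Δ * Q * B).trace *
            ((((N : ℝ) / (2 * ((N : ℝ) ^ 2 - 4)) : ℝ) : ℂ) * (Q * B).trace
              - ((1 / (4 * (N : ℝ)) : ℝ) : ℂ) * (starRingEnd ℂ) (Q * B).trace)).re
        - 2 * ((N : ℝ) / (2 * ((N : ℝ) ^ 2 - 4))) / N *
          (Q * B).trace.im * ((Q * B).trace * (Q * Δ).trace).im) := by
  have hG : (fun Q : Matrix (Fin N) (Fin N) ℂ =>
      ((N : ℝ) ^ 2 / (4 * ((N : ℝ) ^ 2 - 4))) / 2 *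
          ((Q * B * Q * Δ * Q * B).trace.re + (Q * B * Q * B * Q * Δ).trace.re)
        + 2 * ((N : ℝ) ^ 2 / (4 * ((N : ℝ) ^ 2 - 4))) / N * (Q * B).trace.im * (Q * Δ * Q * B).trace.im
        - 1 / 2 * ((Q * B * Q * B).trace *
            ((((N : ℝ) / (2 * ((N : ℝ) ^ 2 - 4)) : ℝ) : ℂ) * (Q * Δ).trace
              - ((1 / (4 * (N : ℝ)) : ℝ) : ℂ) * (starRingEnd ℂ) (Q * Δ).trace)).re
        - 1 / 2 * ((Q * Δ * Q * B).trace *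
            ((((N : ℝ) / (2 * ((N : ℝ) ^ 2 - 4)) : ℝ) : ℂ) * (Q * B).trace
              - ((1 / (4 * (N : ℝ)) : ℝ) : ℂ) * (starRingEnd ℂ) (Q * B).trace)).re
        - 2 * ((N : ℝ) / (2 * ((N : ℝ) ^ 2 - 4))) / N *
          (Q * B).trace.im * ((Q * B).trace * (Q * Δ).trace).im) =
      fun Q : Matrix (Fin N) (Fin N) ℂ =>
        (((N : ℝ) ^ 2 / (4 * ((N : ℝ) ^ 2 - 4))) / 2) * ((Q * B * Q * Δ * Q * B).trace.re + (Q * B * Q * B * Q * Δ).trace.re)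
        + (2 * ((N : ℝ) ^ 2 / (4 * ((N : ℝ) ^ 2 - 4))) / N) * ((Q * B).trace.im * (Q * Δ * Q * B).trace.im)
        + (-(1 / 2)) * ((Q * B * Q * B).trace * ((((N : ℝ) / (2 * ((N : ℝ) ^ 2 - 4)) : ℝ) : ℂ) * (Q * Δ).trace
            - ((1 / (4 * (N : ℝ)) : ℝ) : ℂ) * (starRingEnd ℂ) (Q * Δ).trace)).re
        + (-(1 / 2)) * ((Q * Δ * Q * B).trace * ((((N : ℝ) / (2 * ((N : ℝ) ^ 2 - 4)) : ℝ) : ℂ) * (Q * B).trace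
            - ((1 / (4 * (N : ℝ)) : ℝ) : ℂ) * (starRingEnd ℂ) (Q * B).trace)).re
        + (-(2 * ((N : ℝ) / (2 * ((N : ℝ) ^ 2 - 4))) / N)) * ((Q * B).trace.im * ((Q * B).trace * (Q * Δ).trace).im) := by
    funext Q; ring
  rw [hG]
  have h1 := (contDiff_reTrCubic (N := N) B Δ B).add (contDiff_reTrCubic (N := N) B B Δ)
  have h3 := (contDiff_imTrMul (N := N) B).mul (contDiff_imTrQuad (N := N) Δ B)
  have h4 := contDiff_quad_eta (N := N) ((N : ℝ) / (2 * ((N : ℝ) ^ 2 - 4))) (1 / (4 * (N : ℝ))) B B Δ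
  have h5 := contDiff_quad_eta (N := N) ((N : ℝ) / (2 * ((N : ℝ) ^ 2 - 4))) (1 / (4 * (N : ℝ))) Δ B B
  have h8 := contDiff_im_mul_imProd (N := N) B Δ
  exact ((((contDiff_const.mul h1).add (contDiff_const.mul h3)).add (contDiff_const.mul h4)).add (contDiff_const.mul h5)).add
    (contDiff_const.mul h8)

/-- **The pointwise majorant of `P'`, affine in `‖tr(gB)‖, ‖tr(gΔ)‖, ‖tr(gΔgB)‖, ‖tr(gBgB)‖`**. [folklore] -/
theorem c3primebound_le_affineQ (hN : 3 ≤ N) (B Δ : Matrix (Fin N) (Fin N) ℂ) (g : SUN N) :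
    (3 * ((N : ℝ) ^ 2 / (4 * ((N : ℝ) ^ 2 - 4))) * matrixOpNorm B ^ 2 * frobNorm Δ
        + 2 * ((N : ℝ) ^ 2 / (4 * ((N : ℝ) ^ 2 - 4))) / N *
          (2 * matrixOpNorm B * frobNorm Δ * |((g : Matrix (Fin N) (Fin N) ℂ) * B).trace.im|
            + frobNorm B * ‖((g : Matrix (Fin N) (Fin N) ℂ) * Δ * g * B).trace‖)
        + 1 / 2 * (((N : ℝ) / (2 * ((N : ℝ) ^ 2 - 4))) + 1 / (4 * (N : ℝ))) *
          (2 * matrixOpNorm B * frobNorm B * ‖((g : Matrix (Fin N) (Fin N) ℂ) * Δ).trace‖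
            + frobNorm Δ * ‖((g : Matrix (Fin N) (Fin N) ℂ) * B * g * B).trace‖)
        + 1 / 2 * (((N : ℝ) / (2 * ((N : ℝ) ^ 2 - 4))) + 1 / (4 * (N : ℝ))) *
          (2 * matrixOpNorm B * frobNorm Δ * ‖((g : Matrix (Fin N) (Fin N) ℂ) * B).trace‖
            + frobNorm B * ‖((g : Matrix (Fin N) (Fin N) ℂ) * Δ * g * B).trace‖)
        + 2 * ((N : ℝ) / (2 * ((N : ℝ) ^ 2 - 4))) / N *
          (frobNorm B * |((g : Matrix (Fin N) (Fin N) ℂ) * B).trace.im| * ‖((g : Matrix (Fin N) (Fin N) ℂ) * Δ).trace‖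
            + frobNorm Δ * |((g : Matrix (Fin N) (Fin N) ℂ) * B).trace.im| * ‖((g : Matrix (Fin N) (Fin N) ℂ) * B).trace‖
            + frobNorm B * ‖((g : Matrix (Fin N) (Fin N) ℂ) * B).trace‖ * ‖((g : Matrix (Fin N) (Fin N) ℂ) * Δ).trace‖)) ≤
      (3 * ((N : ℝ) ^ 2 / (4 * ((N : ℝ) ^ 2 - 4))) * matrixOpNorm B ^ 2 * frobNorm Δ)
        + (frobNorm Δ * matrixOpNorm B * (4 * ((N : ℝ) ^ 2 / (4 * ((N : ℝ) ^ 2 - 4))) / N + (((N : ℝ) / (2 * ((N : ℝ) ^ 2 - 4))) + 1 / (4 * (N : ℝ))) + 2 * ((N : ℝ) / (2 * ((N : ℝ) ^ 2 - 4))))) * ‖((g : Matrix (Fin N) (Fin N) ℂ) * B).trace‖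
        + (frobNorm B * ((((N : ℝ) / (2 * ((N : ℝ) ^ 2 - 4))) + 1 / (4 * (N : ℝ))) * matrixOpNorm B + 2 * ((N : ℝ) / (2 * ((N : ℝ) ^ 2 - 4))) * matrixOpNorm B + 2 * ((N : ℝ) / (2 * ((N : ℝ) ^ 2 - 4))) / N * Real.sqrt N * frobNorm B)) * ‖((g : Matrix (Fin N) (Fin N) ℂ) * Δ).trace‖
        + (frobNorm B * (2 * ((N : ℝ) ^ 2 / (4 * ((N : ℝ) ^ 2 - 4))) / N + 1 / 2 * (((N : ℝ) / (2 * ((N : ℝ) ^ 2 - 4))) + 1 / (4 * (N : ℝ))))) * ‖((g : Matrix (Fin N) (Fin N) ℂ) * Δ * g * B).trace‖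
        + (frobNorm Δ * (1 / 2 * (((N : ℝ) / (2 * ((N : ℝ) ^ 2 - 4))) + 1 / (4 * (N : ℝ))))) * ‖((g : Matrix (Fin N) (Fin N) ℂ) * B * g * B).trace‖ := by
  have hN0 : N ≠ 0 := by omega
  have h3 : (3 : ℝ) ≤ N := by exact_mod_cast hN
  have hN4 : (0 : ℝ) < (N : ℝ) ^ 2 - 4 := by nlinarith
  have hNpos : (0 : ℝ) < N := by linarith
  have hsN : 0 < Real.sqrt N := Real.sqrt_pos.2 hNpos
  set κw : ℝ := (N : ℝ) ^ 2 / (4 * ((N : ℝ) ^ 2 - 4)) with hκw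
  set κt : ℝ := (N : ℝ) / (2 * ((N : ℝ) ^ 2 - 4)) with hκt
  have hκw0 : 0 ≤ κw := by positivity
  have hκt0 : 0 ≤ κt := by positivity
  set Q : Matrix (Fin N) (Fin N) ℂ := (g : Matrix (Fin N) (Fin N) ℂ) with hQ
  set r := matrixOpNorm B with hr
  set nB := frobNorm B with hnB
  set nD := frobNorm Δ with hnD
  set z1 := ‖(Q * B).trace‖ with hz1
  set z2 := ‖(Q * Δ).trace‖ with hz2
  set X := |(Q * B).trace.im| with hX
  set w := ‖(Q * Δ * Q * B).trace‖ with hw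
  set wBB := ‖(Q * B * Q * B).trace‖ with hwBB
  have hr0 : 0 ≤ r := matrixOpNorm_nonneg B
  have hnB0 : 0 ≤ nB := frobNorm_nonneg B
  have hnD0 : 0 ≤ nD := frobNorm_nonneg Δ
  have hz10 : 0 ≤ z1 := norm_nonneg _
  have hz20 : 0 ≤ z2 := norm_nonneg _
  have hX0 : 0 ≤ X := abs_nonneg _
  have hw0 : 0 ≤ w := norm_nonneg _
  have hwBB0 : 0 ≤ wBB := norm_nonneg _
  have bX1 : X ≤ z1 := abs_im_le_norm' _
  have bX2 : X ≤ N * r := by rw [hX, hQ]; exact abs_im_trace_su_mul_le_opNorm B g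
  have bz1 : z1 ≤ Real.sqrt N * nB := by rw [hz1, hQ]; exact norm_trace_su_mul_le B g
  have p1 : 2 * r * nD * X ≤ 2 * r * nD * z1 := mul_le_mul_of_nonneg_left bX1 (by positivity)
  have p4 : nB * X * z2 ≤ nB * (N * r) * z2 :=
    mul_le_mul_of_nonneg_right (mul_le_mul_of_nonneg_left bX2 hnB0) hz20
  have p5 : nD * X * z1 ≤ nD * (N * r) * z1 :=
    mul_le_mul_of_nonneg_right (mul_le_mul_of_nonneg_left bX2 hnD0) hz10
  have p6 : nB * z1 * z2 ≤ nB * (Real.sqrt N * nB) * z2 :=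
    mul_le_mul_of_nonneg_right (mul_le_mul_of_nonneg_left bz1 hnB0) hz20
  have hκ1 : 0 ≤ κt + 1 / (4 * (N : ℝ)) := by positivity
  have q1 := mul_le_mul_of_nonneg_left p1 (by positivity : (0 : ℝ) ≤ 2 * κw / N)
  have q4 := mul_le_mul_of_nonneg_left p4 (by positivity : (0 : ℝ) ≤ 2 * κt / N)
  have q5 := mul_le_mul_of_nonneg_left p5 (by positivity : (0 : ℝ) ≤ 2 * κt / N)
  have q6 := mul_le_mul_of_nonneg_left p6 (by positivity : (0 : ℝ) ≤ 2 * κt / N)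
  have hNne : (N : ℝ) ≠ 0 := hNpos.ne'
  have e4 : 2 * κt / N * (nB * (N * r) * z2) = 2 * κt * nB * r * z2 := by
    rw [div_mul_eq_mul_div, div_eq_iff hNne]; ring
  have e5 : 2 * κt / N * (nD * (N * r) * z1) = 2 * κt * nD * r * z1 := by
    rw [div_mul_eq_mul_div, div_eq_iff hNne]; ring
  rw [e4] at q4
  rw [e5] at q5
  simp only [div_eq_mul_inv] at q1 q4 q5 q6 ⊢
  nlinarith [q1, q4, q5, q6, mul_nonneg hκw0 hw0, mul_nonneg hκ1 hw0, mul_nonneg hκ1 hwBB0, mul_nonneg hnB0 hw0,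
    mul_nonneg hnD0 hwBB0]

/-- **The `L²(ν_B)` gradient norm of `c₃'` with the quadratic words in `L²`**:
`√(∫ Γ(c₃',c₃') dν_B) ≤ 3κ_w r²‖Δ‖_F + b₁ Z₁ + b₂ Z₂ + b₃ W_{ΔB} + b₄ W_{BB}`. [folklore] -/
theorem sqrt_integral_Gam_c3prime_le_quad (hN : 3 ≤ N) (B Δ : Matrix (Fin N) (Fin N) ℂ) :
    Real.sqrt (∫ g, Gam (fun Q : Matrix (Fin N) (Fin N) ℂ =>
      ((N : ℝ) ^ 2 / (4 * ((N : ℝ) ^ 2 - 4))) / 2 *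
          ((Q * B * Q * Δ * Q * B).trace.re + (Q * B * Q * B * Q * Δ).trace.re)
        + 2 * ((N : ℝ) ^ 2 / (4 * ((N : ℝ) ^ 2 - 4))) / N * (Q * B).trace.im * (Q * Δ * Q * B).trace.im
        - 1 / 2 * ((Q * B * Q * B).trace *
            ((((N : ℝ) / (2 * ((N : ℝ) ^ 2 - 4)) : ℝ) : ℂ) * (Q * Δ).trace
              - ((1 / (4 * (N : ℝ)) : ℝ) : ℂ) * (starRingEnd ℂ) (Q * Δ).trace)).re
        - 1 / 2 * ((Q * Δ * Q * B).trace *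
            ((((N : ℝ) / (2 * ((N : ℝ) ^ 2 - 4)) : ℝ) : ℂ) * (Q * B).trace
              - ((1 / (4 * (N : ℝ)) : ℝ) : ℂ) * (starRingEnd ℂ) (Q * B).trace)).re
        - 2 * ((N : ℝ) / (2 * ((N : ℝ) ^ 2 - 4))) / N *
          (Q * B).trace.im * ((Q * B).trace * (Q * Δ).trace).im)
        (fun Q : Matrix (Fin N) (Fin N) ℂ =>
      ((N : ℝ) ^ 2 / (4 * ((N : ℝ) ^ 2 - 4))) / 2 *
          ((Q * B * Q * Δ * Q * B).trace.re + (Q * B * Q * B * Q * Δ).trace.re)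
        + 2 * ((N : ℝ) ^ 2 / (4 * ((N : ℝ) ^ 2 - 4))) / N * (Q * B).trace.im * (Q * Δ * Q * B).trace.im
        - 1 / 2 * ((Q * B * Q * B).trace *
            ((((N : ℝ) / (2 * ((N : ℝ) ^ 2 - 4)) : ℝ) : ℂ) * (Q * Δ).trace
              - ((1 / (4 * (N : ℝ)) : ℝ) : ℂ) * (starRingEnd ℂ) (Q * Δ).trace)).re
        - 1 / 2 * ((Q * Δ * Q * B).trace *
            ((((N : ℝ) / (2 * ((N : ℝ) ^ 2 - 4)) : ℝ) : ℂ) * (Q * B).trace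
              - ((1 / (4 * (N : ℝ)) : ℝ) : ℂ) * (starRingEnd ℂ) (Q * B).trace)).re
        - 2 * ((N : ℝ) / (2 * ((N : ℝ) ^ 2 - 4))) / N *
          (Q * B).trace.im * ((Q * B).trace * (Q * Δ).trace).im) g
        ∂(haarProbability (SUN N)).tilted (fun g => (N : ℝ) * ((g : Matrix (Fin N) (Fin N) ℂ) * B).trace.re)) ≤
      (3 * ((N : ℝ) ^ 2 / (4 * ((N : ℝ) ^ 2 - 4))) * matrixOpNorm B ^ 2 * frobNorm Δ)
        + (frobNorm Δ * matrixOpNorm B * (4 * ((N : ℝ) ^ 2 / (4 * ((N : ℝ) ^ 2 - 4))) / N + (((N : ℝ) / (2 * ((N : ℝ) ^ 2 - 4))) + 1 / (4 * (N : ℝ))) + 2 * ((N : ℝ) / (2 * ((N : ℝ) ^ 2 - 4))))) *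
          Real.sqrt (∫ g, ‖((g : Matrix (Fin N) (Fin N) ℂ) * B).trace‖ ^ 2
            ∂(haarProbability (SUN N)).tilted (fun g => (N : ℝ) * ((g : Matrix (Fin N) (Fin N) ℂ) * B).trace.re))
        + (frobNorm B * ((((N : ℝ) / (2 * ((N : ℝ) ^ 2 - 4))) + 1 / (4 * (N : ℝ))) * matrixOpNorm B + 2 * ((N : ℝ) / (2 * ((N : ℝ) ^ 2 - 4))) * matrixOpNorm B + 2 * ((N : ℝ) / (2 * ((N : ℝ) ^ 2 - 4))) / N * Real.sqrt N * frobNorm B)) *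
          Real.sqrt (∫ g, ‖((g : Matrix (Fin N) (Fin N) ℂ) * Δ).trace‖ ^ 2
            ∂(haarProbability (SUN N)).tilted (fun g => (N : ℝ) * ((g : Matrix (Fin N) (Fin N) ℂ) * B).trace.re))
        + (frobNorm B * (2 * ((N : ℝ) ^ 2 / (4 * ((N : ℝ) ^ 2 - 4))) / N + 1 / 2 * (((N : ℝ) / (2 * ((N : ℝ) ^ 2 - 4))) + 1 / (4 * (N : ℝ))))) *
          Real.sqrt (∫ g, ‖((g : Matrix (Fin N) (Fin N) ℂ) * Δ * g * B).trace‖ ^ 2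
            ∂(haarProbability (SUN N)).tilted (fun g => (N : ℝ) * ((g : Matrix (Fin N) (Fin N) ℂ) * B).trace.re))
        + (frobNorm Δ * (1 / 2 * (((N : ℝ) / (2 * ((N : ℝ) ^ 2 - 4))) + 1 / (4 * (N : ℝ))))) *
          Real.sqrt (∫ g, ‖((g : Matrix (Fin N) (Fin N) ℂ) * B * g * B).trace‖ ^ 2
            ∂(haarProbability (SUN N)).tilted (fun g => (N : ℝ) * ((g : Matrix (Fin N) (Fin N) ℂ) * B).trace.re)) := by
  have hN0 : N ≠ 0 := by omega
  have h3 : (3 : ℝ) ≤ N := by exact_mod_cast hN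
  have hN4 : (0 : ℝ) < (N : ℝ) ^ 2 - 4 := by nlinarith
  have hNpos : (0 : ℝ) < N := by linarith
  set κw : ℝ := (N : ℝ) ^ 2 / (4 * ((N : ℝ) ^ 2 - 4)) with hκw
  set κt : ℝ := (N : ℝ) / (2 * ((N : ℝ) ^ 2 - 4)) with hκt
  set c : ℝ := 1 / (4 * (N : ℝ)) with hc
  have hκw0 : 0 ≤ κw := by positivity
  have hκt0 : 0 ≤ κt := by positivity
  have hc0 : 0 ≤ c := by positivity
  set ν : Measure (SUN N) := (haarProbability (SUN N)).tilted (fun g => (N : ℝ) * ((g : Matrix (Fin N) (Fin N) ℂ) * B).trace.re) with hν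
  have hexpi : Integrable (fun g : SUN N => Real.exp ((N : ℝ) * ((g : Matrix (Fin N) (Fin N) ℂ) * B).trace.re))
      (haarProbability (SUN N)) :=
    integrable_of_continuous_SUN (Real.continuous_exp.comp (continuous_restrict (contDiff_pot (N : ℝ) B))) _
  haveI : IsProbabilityMeasure ν := isProbabilityMeasure_tilted hexpi
  have hc3 := contDiff_c3prime N B Δ
  rw [← hκw, ← hκt] at hc3
  have hB0 := matrixOpNorm_nonneg B
  have hBF := frobNorm_nonneg B
  have hΔ := frobNorm_nonneg Δ
  set a : ℝ := 3 * κw * matrixOpNorm B ^ 2 * frobNorm Δ with ha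
  set b₁ : ℝ := frobNorm Δ * matrixOpNorm B * (4 * κw / N + (κt + c) + 2 * κt) with hb₁
  set b₂ : ℝ := frobNorm B * ((κt + c) * matrixOpNorm B + 2 * κt * matrixOpNorm B + 2 * κt / N * Real.sqrt N * frobNorm B)
    with hb₂
  set b₃ : ℝ := frobNorm B * (2 * κw / N + 1 / 2 * (κt + c)) with hb₃
  set b₄ : ℝ := frobNorm Δ * (1 / 2 * (κt + c)) with hb₄
  have ha0 : 0 ≤ a := by positivity
  have hb₁0 : 0 ≤ b₁ := by positivity
  have hb₂0 : 0 ≤ b₂ := by positivity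
  have hb₃0 : 0 ≤ b₃ := by positivity
  have hb₄0 : 0 ≤ b₄ := by positivity
  set fb : SUN N → ℝ := fun g => b₁ * ‖((g : Matrix (Fin N) (Fin N) ℂ) * B).trace‖ with hfb
  set fc : SUN N → ℝ := fun g => b₂ * ‖((g : Matrix (Fin N) (Fin N) ℂ) * Δ).trace‖ with hfc
  set fd : SUN N → ℝ := fun g => b₃ * ‖((g : Matrix (Fin N) (Fin N) ℂ) * Δ * (g : Matrix (Fin N) (Fin N) ℂ) * B).trace‖ with hfd
  set fe : SUN N → ℝ := fun g => b₄ * ‖((g : Matrix (Fin N) (Fin N) ℂ) * B * (g : Matrix (Fin N) (Fin N) ℂ) * B).trace‖ with hfe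
  have cG : Continuous fun g : SUN N => (g : Matrix (Fin N) (Fin N) ℂ) := continuous_subtype_val
  have htr : ∀ M : Matrix (Fin N) (Fin N) ℂ, Continuous fun g : SUN N => ((g : Matrix (Fin N) (Fin N) ℂ) * M).trace :=
    fun M => (cG.matrix_mul continuous_const).matrix_trace
  have hquad : ∀ M₁ M₂ : Matrix (Fin N) (Fin N) ℂ,
      Continuous fun g : SUN N => ((g : Matrix (Fin N) (Fin N) ℂ) * M₁ * (g : Matrix (Fin N) (Fin N) ℂ) * M₂).trace :=
    fun M₁ M₂ => (((cG.matrix_mul continuous_const).matrix_mul cG).matrix_mul continuous_const).matrix_trace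
  have hfbc : Continuous fb := continuous_const.mul (continuous_norm.comp (htr B))
  have hfcc : Continuous fc := continuous_const.mul (continuous_norm.comp (htr Δ))
  have hfdc : Continuous fd := continuous_const.mul (continuous_norm.comp (hquad Δ B))
  have hfec : Continuous fe := continuous_const.mul (continuous_norm.comp (hquad B B))
  have key := sqrt_integral_le_of_le_add_sq_four (a := a) (continuous_restrict (contDiff_Gam hc3 hc3)) hfbc hfcc hfdc hfec ha0
    (fun g => ?_) ν
  · have esq : ∀ (β : ℝ) (f : SUN N → ℝ), 0 ≤ β →
        Real.sqrt (∫ x, (β * f x) ^ 2 ∂ν) = β * Real.sqrt (∫ x, f x ^ 2 ∂ν) := by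
      intro β f hβ
      have : (fun x => (β * f x) ^ 2) = fun x => β ^ 2 * f x ^ 2 := by funext x; ring
      rw [this, integral_const_mul, Real.sqrt_mul (sq_nonneg _), Real.sqrt_sq hβ]
    have eb := esq b₁ (fun g => ‖((g : Matrix (Fin N) (Fin N) ℂ) * B).trace‖) hb₁0
    have ec := esq b₂ (fun g => ‖((g : Matrix (Fin N) (Fin N) ℂ) * Δ).trace‖) hb₂0
    have ed := esq b₃ (fun g => ‖((g : Matrix (Fin N) (Fin N) ℂ) * Δ * (g : Matrix (Fin N) (Fin N) ℂ) * B).trace‖) hb₃0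
    have ee := esq b₄ (fun g => ‖((g : Matrix (Fin N) (Fin N) ℂ) * B * (g : Matrix (Fin N) (Fin N) ℂ) * B).trace‖) hb₄0
    simp only [hfb, hfc, hfd, hfe] at key
    rw [eb, ec, ed, ee] at key
    exact key
  · have hP := Gam_c3prime_le hN B Δ g
    have haff := c3primebound_le_affineQ hN B Δ g
    rw [← hκw, ← hκt, ← hc] at haff hP
    have hP0 : 0 ≤ 3 * κw * matrixOpNorm B ^ 2 * frobNorm Δ
        + 2 * κw / N *
          (2 * matrixOpNorm B * frobNorm Δ * |((g : Matrix (Fin N) (Fin N) ℂ) * B).trace.im|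
            + frobNorm B * ‖((g : Matrix (Fin N) (Fin N) ℂ) * Δ * g * B).trace‖)
        + 1 / 2 * (κt + c) *
          (2 * matrixOpNorm B * frobNorm B * ‖((g : Matrix (Fin N) (Fin N) ℂ) * Δ).trace‖
            + frobNorm Δ * ‖((g : Matrix (Fin N) (Fin N) ℂ) * B * g * B).trace‖)
        + 1 / 2 * (κt + c) *
          (2 * matrixOpNorm B * frobNorm Δ * ‖((g : Matrix (Fin N) (Fin N) ℂ) * B).trace‖
            + frobNorm B * ‖((g : Matrix (Fin N) (Fin N) ℂ) * Δ * g * B).trace‖)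
        + 2 * κt / N *
          (frobNorm B * |((g : Matrix (Fin N) (Fin N) ℂ) * B).trace.im| * ‖((g : Matrix (Fin N) (Fin N) ℂ) * Δ).trace‖
            + frobNorm Δ * |((g : Matrix (Fin N) (Fin N) ℂ) * B).trace.im| * ‖((g : Matrix (Fin N) (Fin N) ℂ) * B).trace‖
            + frobNorm B * ‖((g : Matrix (Fin N) (Fin N) ℂ) * B).trace‖ * ‖((g : Matrix (Fin N) (Fin N) ℂ) * Δ).trace‖) := by
      positivity
    simp only [hfb, hfc, hfd, hfe]
    calc _ ≤ _ := hP
      _ ≤ (a + b₁ * ‖((g : Matrix (Fin N) (Fin N) ℂ) * B).trace‖ + b₂ * ‖((g : Matrix (Fin N) (Fin N) ℂ) * Δ).trace‖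
            + b₃ * ‖((g : Matrix (Fin N) (Fin N) ℂ) * Δ * (g : Matrix (Fin N) (Fin N) ℂ) * B).trace‖
            + b₄ * ‖((g : Matrix (Fin N) (Fin N) ℂ) * B * (g : Matrix (Fin N) (Fin N) ℂ) * B).trace‖) ^ 2 := by
          refine pow_le_pow_left₀ hP0 ?_ 2
          calc _ ≤ _ := haff
            _ = _ := by simp only [ha, hb₁, hb₂, hb₃, hb₄]

end Summit.Ventures.YMGap.OneLinkEigen
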